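import Mathlib.Analysis.Calculus.MeanValue
import Mathlib.Analysis.Calculus.ContDiff.RCLike
import Mathlib.Topology.MetricSpace.Thickening
import Literature.Analysis.Convexity.Secant
import Literature.Analysis.Convexity.ComplexTransport
import HarnessLib

/-!
# Estimates for the straightening step (Munkres 9.3, 8.8, 10.2 combined)

The analytic core of the *fitting together* of smooth triangulations, isolated from all
topology of the manifold.  Let `G` be smooth near a closed simplex with derivative bounded by
`B₁`, `B₂`-Lipschitz derivative and derivative bounded below by `μ` on the direction space, let
`t` be a small (`diam ≤ δ`) `c`-non-degenerate sub-simplex and `A` the secant map of `G` on `t`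
(`Literature.Analysis.Convexity.Secant`).  We prove, with explicit constants tending to `0` with
`δ`:

* `exists_balanced_of_mem_vectorSpan` — directions of a simplex are balanced combinations of
  its vertices;
* `norm_linear_sub_apply_le` — `‖(A.linear - G'(x)) u‖ ≤ κ' ‖u‖` on the direction space;
* `hasFDerivAt_bend`, `norm_bend_fderiv_sub_le`, `injOn_of_norm_sub_le` — for the *bent map*
  `B = G + (θ ∘ G) • (A - G)` (with a cut-off `θ`, `0 ≤ θ ≤ 1`, `‖θ'‖ ≤ Θ`), the derivative is
  within `Θ B₁² δ + κ'` of `G'(x)`, hence injective on the direction space once this is `< μ`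
  (Munkres 8.8: a `C¹`-small perturbation of an immersion is an immersion);
* `lipschitzOnWith_displacement` — the displacement `w`, `w (G x) = A x - G x`, is
  `((κ + B₂ δ) / μ')`-Lipschitz on the image piece `G '' convexHull t` when `G` is
  `μ'`-bi-Lipschitz below there (the input to the contraction argument of Munkres 10.2 /
  `ApproximatesLinearOn`);
* `exists_constants_of_contDiffOn` — the constants `B₁, B₂` on a compact thickening inside the
  domain of smoothness.

No named facts are introduced.
-/

open Set Function Metric
open scoped Topology NNReal ContDiff

noncomputable section

namespace Literature.Analysis.Convexity

section Balanced

variable {W : Type*} [AddCommGroup W] [Module ℝ W]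

/-- **Directions are balanced combinations of vertices.** An element of the vector span of a
finite configuration `t` is `∑ v ∈ t, c v • v` with `∑ v ∈ t, c v = 0`. [folklore] -/
theorem exists_balanced_of_mem_vectorSpan [DecidableEq W] {t : Finset W} {u : W}
    (hu : u ∈ vectorSpan ℝ (t : Set W)) :
    ∃ c : W → ℝ, ∑ v ∈ t, c v = 0 ∧ ∑ v ∈ t, c v • v = u := by
  rcases t.eq_empty_or_nonempty with rfl | ⟨v₀, hv₀⟩
  · simp only [Finset.coe_empty, vectorSpan_empty, Submodule.mem_bot] at hu
    exact ⟨0, by simp, by simp [hu]⟩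
  rw [vectorSpan_eq_span_vsub_set_right ℝ (Finset.mem_coe.2 hv₀)] at hu
  have himg : ((· -ᵥ v₀) '' (t : Set W)) = ↑(t.image fun v => v - v₀) := by
    rw [Finset.coe_image]; rfl
  rw [himg, Submodule.mem_span_finset] at hu
  obtain ⟨a, -, ha⟩ := hu
  rw [Finset.sum_image (fun v _ v' _ h => sub_left_injective h)] at ha
  refine ⟨fun v => a (v - v₀) - if v = v₀ then ∑ v' ∈ t, a (v' - v₀) else 0, ?_, ?_⟩
  · rw [Finset.sum_sub_distrib, Finset.sum_ite_eq' t v₀, if_pos hv₀, sub_self]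
  · simp only [sub_smul, Finset.sum_sub_distrib, ite_smul, zero_smul, Finset.sum_ite_eq', if_pos hv₀]
    rw [← ha]
    simp only [smul_sub, Finset.sum_sub_distrib, Finset.sum_smul]

end Balanced

section Estimates

variable {W : Type*} [NormedAddCommGroup W] [NormedSpace ℝ W]
  {V : Type*} [NormedAddCommGroup V] [NormedSpace ℝ V]

/-- **Derivative estimate for the secant map on the direction space** (Munkres 9.3, derivative
form). If `t` is `c`-non-degenerate, `x ∈ convexHull t`, and the vertexwise estimate
`‖(A v - A x) - φ (v - x)‖ ≤ κ ‖v - x‖` holds (for the secant map `A` of `G` and `φ = G'(x)`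
this is the Taylor estimate), then `‖(A.linear - φ) u‖ ≤ (#t * κ / c) * ‖u‖` for every `u` in
the direction space `vectorSpan ℝ t` (write `u` as a balanced combination; the diameter cancels
against the non-degeneracy). [folklore] -/
theorem norm_linear_sub_apply_le [DecidableEq W] {t : Finset W} {A : W →ᵃ[ℝ] V} (φ : W →L[ℝ] V)
    {c : ℝ} (hc : 0 < c) (ht : Nondegenerate c t) {x : W} (hx : x ∈ convexHull ℝ (t : Set W))
    {κ : ℝ} (hκ : 0 ≤ κ) (hA : ∀ v ∈ t, ‖(A v - A x) - φ (v - x)‖ ≤ κ * ‖v - x‖)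
    {u : W} (hu : u ∈ vectorSpan ℝ (t : Set W)) :
    ‖A.linear u - φ u‖ ≤ (t.card * κ / c) * ‖u‖ := by
  obtain ⟨cw, hc0, rfl⟩ := exists_balanced_of_mem_vectorSpan hu
  -- the balanced combination identity
  have key : A.linear (∑ v ∈ t, cw v • v) - φ (∑ v ∈ t, cw v • v) =
      ∑ v ∈ t, cw v • ((A v - A x) - φ (v - x)) := by
    have hAv : ∀ v, A v = A.linear v + A 0 := fun v => by
      have := A.map_vadd 0 v
      rw [vadd_eq_add, add_zero] at this
      rw [this, vadd_eq_add]
    simp only [map_sum, map_smul, smul_sub, map_sub, Finset.sum_sub_distrib]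
    have h1 : ∑ v ∈ t, cw v • A v = ∑ v ∈ t, cw v • A.linear v := by
      rw [show (∑ v ∈ t, cw v • A v) = ∑ v ∈ t, (cw v • A.linear v + cw v • A 0) from
        Finset.sum_congr rfl fun v _ => by rw [hAv v, smul_add], Finset.sum_add_distrib,
        ← Finset.sum_smul, hc0, zero_smul, add_zero]
    rw [h1, show (∑ v ∈ t, cw v • A x) = 0 by rw [← Finset.sum_smul, hc0, zero_smul],
      show (∑ v ∈ t, cw v • φ x) = 0 by rw [← Finset.sum_smul, hc0, zero_smul]]
    abel
  rw [key]
  -- the diameter and the weight bound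
  rcases t.eq_empty_or_nonempty with rfl | hne
  · simp
  obtain ⟨q, hq, hqmax⟩ := Finset.exists_max_image (t ×ˢ t) (fun q => ‖q.1 - q.2‖) (hne.product hne)
  set D : ℝ := ‖q.1 - q.2‖ with hD
  have hDmax : ∀ u ∈ t, ∀ u' ∈ t, ‖u - u'‖ ≤ D := fun u hu u' hu' =>
    hqmax (u, u') (Finset.mem_product.2 ⟨hu, hu'⟩)
  have hq1 : q.1 ∈ t := (Finset.mem_product.1 hq).1
  have hq2 : q.2 ∈ t := (Finset.mem_product.1 hq).2
  rcases (norm_nonneg (q.1 - q.2) : 0 ≤ D).lt_or_eq with hDpos | hD0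
  · have hwb : ∀ v ∈ t, |cw v| ≤ ‖∑ v ∈ t, cw v • v‖ / (c * D) := fun v hv => by
      rw [le_div_iff₀ (mul_pos hc hDpos)]
      have := ht cw hc0 v hv q.1 hq1 q.2 hq2
      linarith
    calc ‖∑ v ∈ t, cw v • ((A v - A x) - φ (v - x))‖
        ≤ ∑ v ∈ t, ‖cw v • ((A v - A x) - φ (v - x))‖ := norm_sum_le _ _
      _ ≤ ∑ v ∈ t, ‖∑ v ∈ t, cw v • v‖ / (c * D) * (κ * D) := Finset.sum_le_sum fun v hv => by
          rw [norm_smul, Real.norm_eq_abs]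
          refine mul_le_mul (hwb v hv) ((hA v hv).trans ?_) (norm_nonneg _)
            (div_nonneg (norm_nonneg _) (mul_pos hc hDpos).le)
          exact mul_le_mul_of_nonneg_left (norm_sub_le_of_mem_convexHull hx hDmax hv) hκ
      _ = t.card * (‖∑ v ∈ t, cw v • v‖ / (c * D) * (κ * D)) := by rw [Finset.sum_const, nsmul_eq_mul]
      _ = t.card * κ / c * ‖∑ v ∈ t, cw v • v‖ := by
          have hD0 : D ≠ 0 := hDpos.ne'
          field_simp
  · -- all vertices coincide: the balanced combination vanishes
    have hall : ∀ u ∈ t, ∀ u' ∈ t, u = u' := fun u hu u' hu' => by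
      have := hDmax u hu u' hu'
      rw [hD, ← hD0] at this
      exact sub_eq_zero.1 (norm_le_zero_iff.1 this)
    obtain ⟨v₀, hv₀⟩ := hne
    have h0 : ∑ v ∈ t, cw v • ((A v - A x) - φ (v - x)) = 0 := by
      rw [show (∑ v ∈ t, cw v • ((A v - A x) - φ (v - x))) =
          ∑ v ∈ t, cw v • ((A v₀ - A x) - φ (v₀ - x)) from
        Finset.sum_congr rfl fun v hv => by rw [hall v hv v₀ hv₀], ← Finset.sum_smul, hc0, zero_smul]
    rw [h0, norm_zero]
    positivity

/-- An affine map on a finite-dimensional space is differentiable with derivative its linear part.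
[folklore] -/
theorem hasFDerivAt_affineMap [FiniteDimensional ℝ W] (A : W →ᵃ[ℝ] V) (x : W) :
    HasFDerivAt A (LinearMap.toContinuousLinearMap A.linear) x := by
  have hA : (A : W → V) = fun y => LinearMap.toContinuousLinearMap A.linear y + A 0 := by
    funext y
    have := A.map_vadd 0 y
    rw [vadd_eq_add, add_zero] at this
    rw [this, vadd_eq_add]
    rfl
  rw [hA]
  exact ((LinearMap.toContinuousLinearMap A.linear).hasFDerivAt).add_const (A 0)

/-- **Derivative of the bent map** `B = G + (θ ∘ G) • (A - G)`. [folklore] -/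
theorem hasFDerivAt_bend [FiniteDimensional ℝ W] {G : W → V} {G' : W →L[ℝ] V} {θ : V → ℝ}
    {θ' : V →L[ℝ] ℝ} (A : W →ᵃ[ℝ] V) {x : W} (hG : HasFDerivAt G G' x)
    (hθ : HasFDerivAt θ θ' (G x)) :
    HasFDerivAt (fun y => G y + θ (G y) • (A y - G y))
      (G' + (θ (G x) • (LinearMap.toContinuousLinearMap A.linear - G') +
        (θ'.comp G').smulRight (A x - G x))) x :=
  hG.add ((hθ.comp x hG).smul ((hasFDerivAt_affineMap A x).sub hG))

/-- **The bent derivative is close to `G'`**: if `0 ≤ θ ≤ 1`, `‖θ'‖ ≤ Θ`, `‖G'‖ ≤ B₁`,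
`‖A x - G x‖ ≤ δ₀` and `‖(A.linear - G') u‖ ≤ κ' ‖u‖` on the subspace `Dir`, then for
`u ∈ Dir` the bent derivative differs from `G' u` by at most `(κ' + Θ * B₁ * δ₀) ‖u‖`.
[folklore] -/
theorem norm_bend_fderiv_sub_le [FiniteDimensional ℝ W] {G' : W →L[ℝ] V} {θx : ℝ} {θ' : V →L[ℝ] ℝ}
    {A : W →ᵃ[ℝ] V} {Gx Ax : V} (hθ0 : 0 ≤ θx) (hθ1 : θx ≤ 1) {Θ B₁ δ₀ κ' : ℝ}
    (hΘ : ‖θ'‖ ≤ Θ) (hB₁ : ‖G'‖ ≤ B₁) (hδ₀ : ‖Ax - Gx‖ ≤ δ₀) {Dir : Submodule ℝ W}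
    (hκ' : ∀ u ∈ Dir, ‖LinearMap.toContinuousLinearMap A.linear u - G' u‖ ≤ κ' * ‖u‖)
    {u : W} (hu : u ∈ Dir) :
    ‖(G' + (θx • (LinearMap.toContinuousLinearMap A.linear - G') +
        (θ'.comp G').smulRight (Ax - Gx))) u - G' u‖ ≤ (κ' + Θ * B₁ * δ₀) * ‖u‖ := by
  have hΘ0 : 0 ≤ Θ := (norm_nonneg _).trans hΘ
  have hB₁0 : 0 ≤ B₁ := (norm_nonneg _).trans hB₁
  have happ : (G' + (θx • (LinearMap.toContinuousLinearMap A.linear - G') +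
      (θ'.comp G').smulRight (Ax - Gx))) u - G' u =
      θx • (LinearMap.toContinuousLinearMap A.linear u - G' u) + (θ' (G' u)) • (Ax - Gx) := by
    show G' u + (θx • (LinearMap.toContinuousLinearMap A.linear u - G' u) + (θ' (G' u)) • (Ax - Gx)) -
      G' u = _
    abel
  rw [happ]
  calc ‖θx • (LinearMap.toContinuousLinearMap A.linear u - G' u) + (θ' (G' u)) • (Ax - Gx)‖
      ≤ ‖θx • (LinearMap.toContinuousLinearMap A.linear u - G' u)‖ + ‖(θ' (G' u)) • (Ax - Gx)‖ :=
        norm_add_le _ _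
    _ ≤ κ' * ‖u‖ + Θ * B₁ * δ₀ * ‖u‖ := by
        refine add_le_add ?_ ?_
        · rw [norm_smul, Real.norm_of_nonneg hθ0]
          calc θx * ‖LinearMap.toContinuousLinearMap A.linear u - G' u‖
              ≤ 1 * (κ' * ‖u‖) := mul_le_mul hθ1 (hκ' u hu) (norm_nonneg _) zero_le_one
            _ = κ' * ‖u‖ := one_mul _
        · rw [norm_smul]
          have h1 : ‖θ' (G' u)‖ ≤ Θ * (B₁ * ‖u‖) :=
            (θ'.le_opNorm _).trans (mul_le_mul hΘ ((G'.le_opNorm u).trans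
              (mul_le_mul_of_nonneg_right hB₁ (norm_nonneg _))) (norm_nonneg _) hΘ0)
          calc ‖θ' (G' u)‖ * ‖Ax - Gx‖ ≤ Θ * (B₁ * ‖u‖) * δ₀ :=
                mul_le_mul h1 hδ₀ (norm_nonneg _) (by positivity)
            _ = Θ * B₁ * δ₀ * ‖u‖ := by ring
    _ = (κ' + Θ * B₁ * δ₀) * ‖u‖ := by ring

/-- **Perturbed immersions are immersions** (Munkres 8.8, derivative part): if `μ ‖u‖ ≤ ‖G' u‖`
on `Dir` and the linear map `B'` satisfies `‖B' u - G' u‖ ≤ κ'' ‖u‖` on `Dir` with `κ'' < μ`,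
then `B'` is injective on `Dir`. [cite: Munkres1966, Theorem 8.8] -/
theorem injOn_of_norm_sub_le {G' B' : W →L[ℝ] V} {Dir : Submodule ℝ W} {μ κ'' : ℝ}
    (hμ : ∀ u ∈ Dir, μ * ‖u‖ ≤ ‖G' u‖) (hB : ∀ u ∈ Dir, ‖B' u - G' u‖ ≤ κ'' * ‖u‖)
    (hlt : κ'' < μ) : ∀ u ∈ Dir, B' u = 0 → u = 0 := by
  intro u hu h0
  have h1 := hμ u hu
  have h2 := hB u hu
  rw [h0, zero_sub, norm_neg] at h2
  by_contra hne
  have hpos : 0 < ‖u‖ := norm_pos_iff.2 hne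
  nlinarith

/-- Two points of a closed simplex are at distance at most the diameter of the vertex set.
[folklore] -/
theorem norm_sub_le_of_mem_convexHull_two {t : Finset W} {x y : W}
    (hx : x ∈ convexHull ℝ (t : Set W)) (hy : y ∈ convexHull ℝ (t : Set W)) {D : ℝ}
    (hD : ∀ u ∈ t, ∀ u' ∈ t, ‖u - u'‖ ≤ D) : ‖y - x‖ ≤ D := by
  obtain ⟨w, hw0, hw1, hwy⟩ := Finset.mem_convexHull'.1 hy
  have hyx : y - x = ∑ u ∈ t, w u • (u - x) := by
    rw [← hwy]
    simp only [smul_sub, Finset.sum_sub_distrib, ← Finset.sum_smul, hw1, one_smul]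
  rw [hyx]
  calc ‖∑ u ∈ t, w u • (u - x)‖ ≤ ∑ u ∈ t, ‖w u • (u - x)‖ := norm_sum_le _ _
    _ = ∑ u ∈ t, w u * ‖u - x‖ := Finset.sum_congr rfl fun u hu => by
        rw [norm_smul, Real.norm_of_nonneg (hw0 u hu)]
    _ ≤ ∑ u ∈ t, w u * D := Finset.sum_le_sum fun u hu =>
        mul_le_mul_of_nonneg_left (norm_sub_le_of_mem_convexHull hx hD hu) (hw0 u hu)
    _ = D := by rw [← Finset.sum_mul, hw1, one_mul]

/-- **The displacement is Lipschitz-small on image pieces** (input to Munkres 10.2 / the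
contraction argument). Let `A` be the secant map of `G` on the `c`-non-degenerate configuration
`t` of diameter `≤ δ`, let `G` have `B₂`-Lipschitz derivative `G'` on `convexHull t`
(`HasFDerivWithinAt`), and let `G` be `μ'`-bi-Lipschitz below there. If `w (G x) = A x - G x`
for `x ∈ convexHull t`, then `w` is `((#t * B₂ * δ / c + B₂ * δ) / μ')`-Lipschitz on
`G '' convexHull t`. [folklore] -/
theorem lipschitzOnWith_displacement [DecidableEq W] {t : Finset W} {G : W → V} {G' : W → W →L[ℝ] V}
    {A : W →ᵃ[ℝ] V} (hA : ∀ v ∈ t, A v = G v) {c : ℝ} (hc : 0 < c) (ht : Nondegenerate c t)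
    {δ : ℝ} (hδ : 0 ≤ δ) (hdiam : ∀ u ∈ t, ∀ u' ∈ t, ‖u - u'‖ ≤ δ)
    (hG : ∀ z ∈ convexHull ℝ (t : Set W), HasFDerivWithinAt G (G' z) (convexHull ℝ (t : Set W)) z)
    {B₂ : ℝ≥0} (hL : LipschitzOnWith B₂ G' (convexHull ℝ (t : Set W)))
    {μ' : ℝ} (hμ' : 0 < μ')
    (hbi : ∀ x ∈ convexHull ℝ (t : Set W), ∀ y ∈ convexHull ℝ (t : Set W), μ' * ‖y - x‖ ≤ ‖G y - G x‖)
    {w : V → V} (hw : ∀ x ∈ convexHull ℝ (t : Set W), w (G x) = A x - G x) :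
    ∀ p ∈ G '' convexHull ℝ (t : Set W), ∀ q ∈ G '' convexHull ℝ (t : Set W),
      ‖w q - w p‖ ≤ ((t.card * (B₂ * δ) / c + B₂ * δ) / μ') * ‖q - p‖ := by
  rintro _ ⟨x, hx, rfl⟩ _ ⟨y, hy, rfl⟩
  rw [hw x hx, hw y hy]
  have hB₂ : (0 : ℝ) ≤ B₂ := B₂.2
  -- Taylor estimates at `x`
  have htaylor : ∀ v ∈ convexHull ℝ (t : Set W), ‖G v - G x - G' x (v - x)‖ ≤ (B₂ * ‖v - x‖) * ‖v - x‖ :=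
    fun v hv => norm_sub_sub_fderiv_le_of_lipschitzOnWith (convex_convexHull ℝ _) hG hL hx hv
  have hvert : ∀ v ∈ t, ‖G v - G x - G' x (v - x)‖ ≤ (B₂ * δ) * ‖v - x‖ := fun v hv =>
    (htaylor v (subset_convexHull ℝ _ hv)).trans (mul_le_mul_of_nonneg_right
      (mul_le_mul_of_nonneg_left (norm_sub_le_of_mem_convexHull hx hdiam hv) hB₂) (norm_nonneg _))
  have h1 : ‖(A y - A x) - G' x (y - x)‖ ≤ (t.card * (B₂ * δ) / c) * ‖y - x‖ :=
    norm_secant_sub_sub_le hA hc ht hx hy (G' x) (by positivity) hvert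
  have hyx : ‖y - x‖ ≤ δ := norm_sub_le_of_mem_convexHull_two hx hy hdiam
  have h2 : ‖G y - G x - G' x (y - x)‖ ≤ (B₂ * δ) * ‖y - x‖ :=
    (htaylor y hy).trans (mul_le_mul_of_nonneg_right (mul_le_mul_of_nonneg_left hyx hB₂) (norm_nonneg _))
  have h3 : ‖(A y - G y) - (A x - G x)‖ ≤ (t.card * (B₂ * δ) / c + B₂ * δ) * ‖y - x‖ := by
    calc ‖(A y - G y) - (A x - G x)‖ = ‖((A y - A x) - G' x (y - x)) - (G y - G x - G' x (y - x))‖ := by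
          congr 1; abel
      _ ≤ ‖(A y - A x) - G' x (y - x)‖ + ‖G y - G x - G' x (y - x)‖ := norm_sub_le _ _
      _ ≤ (t.card * (B₂ * δ) / c) * ‖y - x‖ + (B₂ * δ) * ‖y - x‖ := add_le_add h1 h2
      _ = (t.card * (B₂ * δ) / c + B₂ * δ) * ‖y - x‖ := by ring
  have h4 : ‖y - x‖ ≤ ‖G y - G x‖ / μ' := by
    rw [le_div_iff₀ hμ', mul_comm]
    exact hbi x hx y hy
  have hK0 : 0 ≤ t.card * (B₂ * δ) / c + B₂ * δ := by positivity
  calc ‖(A y - G y) - (A x - G x)‖ ≤ (t.card * (B₂ * δ) / c + B₂ * δ) * ‖y - x‖ := h3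
    _ ≤ (t.card * (B₂ * δ) / c + B₂ * δ) * (‖G y - G x‖ / μ') := mul_le_mul_of_nonneg_left h4 hK0
    _ = (t.card * (B₂ * δ) / c + B₂ * δ) / μ' * ‖G y - G x‖ := by ring

end Estimates





section Constants

variable {W : Type*} [NormedAddCommGroup W] [NormedSpace ℝ W] [FiniteDimensional ℝ W]
  {V : Type*} [NormedAddCommGroup V] [NormedSpace ℝ V]

/-- **Constants on a compact piece.** If `G` is `C^∞` on the open set `O ⊇ Q`, `Q` compact, then
on some compact thickening of `Q` inside `O` the derivative of `G` is bounded by `B₁` and, on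
every convex subset, `G` is `B₁`-Lipschitz and `fderiv G` is `B₂`-Lipschitz. [folklore] -/
theorem exists_constants_of_contDiffOn {G : W → V} {O : Set W} (hO : IsOpen O)
    (hG : ContDiffOn ℝ ∞ G O) {Q : Set W} (hQ : IsCompact Q) (hQO : Q ⊆ O) :
    ∃ ρ > 0, ∃ B₁ B₂ : ℝ≥0, cthickening ρ Q ⊆ O ∧ (∀ x ∈ cthickening ρ Q, ‖fderiv ℝ G x‖ ≤ B₁) ∧
      ∀ S, Convex ℝ S → S ⊆ cthickening ρ Q →
        LipschitzOnWith B₁ G S ∧ LipschitzOnWith B₂ (fderiv ℝ G) S := by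
  obtain ⟨ρ, hρ, hρO⟩ := hQ.exists_cthickening_subset_open hO hQO
  have hC : IsCompact (cthickening ρ Q) := hQ.cthickening
  -- first derivative
  have hdiff : ∀ x ∈ O, DifferentiableAt ℝ G x := fun x hx =>
    (hG.contDiffAt (hO.mem_nhds hx)).differentiableAt (by simp)
  have hG1 : ContDiffOn ℝ ∞ (fderiv ℝ G) O := hG.fderiv_of_isOpen hO (by simp)
  have hcont1 : ContinuousOn (fderiv ℝ G) (cthickening ρ Q) := hG1.continuousOn.mono hρO
  obtain ⟨C₁, hC₁⟩ := hC.exists_bound_of_continuousOn hcont1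
  -- second derivative
  have hdiff1 : ∀ x ∈ O, DifferentiableAt ℝ (fderiv ℝ G) x := fun x hx =>
    (hG1.contDiffAt (hO.mem_nhds hx)).differentiableAt (by simp)
  have hG2 : ContDiffOn ℝ ∞ (fderiv ℝ (fderiv ℝ G)) O := hG1.fderiv_of_isOpen hO (by simp)
  obtain ⟨C₂, hC₂⟩ : ∃ C₂, ∀ x ∈ cthickening ρ Q, ‖fderiv ℝ (fderiv ℝ G) x‖ ≤ C₂ := by
    obtain ⟨C₂, hC₂⟩ := ((hC.image_of_continuousOn (hG2.continuousOn.mono hρO)).isBounded).exists_norm_le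
    exact ⟨C₂, fun x hx => hC₂ _ (Set.mem_image_of_mem _ hx)⟩
  refine ⟨ρ, hρ, ⟨max C₁ 0, le_max_right _ _⟩, ⟨max C₂ 0, le_max_right _ _⟩, hρO,
    fun x hx => (hC₁ x hx).trans (le_max_left _ _), fun S hS hSC => ⟨?_, ?_⟩⟩
  · refine hS.lipschitzOnWith_of_nnnorm_fderiv_le (fun x hx => hdiff x (hρO (hSC hx))) fun x hx => ?_
    show ‖fderiv ℝ G x‖ ≤ max C₁ 0
    exact (hC₁ x (hSC hx)).trans (le_max_left _ _)
  · refine hS.lipschitzOnWith_of_nnnorm_fderiv_le (fun x hx => hdiff1 x (hρO (hSC hx))) fun x hx => ?_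
    show ‖fderiv ℝ (fderiv ℝ G) x‖ ≤ max C₂ 0
    exact (hC₂ x (hSC hx)).trans (le_max_left _ _)

end Constants

end Literature.Analysis.Convexity
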